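import Summits.Ventures.YMGap.RobustBall.DobrushinSupersolution
import Summits.Ventures.YMGap.RobustBall.SlabAxisCriterion
import Summits.Ventures.YMGap.RobustBall.StringTensionExplicit
import HarnessLib

/-!
# Robust ball (Y2), area-law side — area law and string-tension floor UNIFORM ON THE TIER-1 BALL at AXIS rate

HONEST FRAMING: venture file of the cell `pub-ymgap` (QuantumFields programme), track ROBUST-BALL, seat rb-p2 (g10).  Strong-coupling
LATTICE statements (tori `(ℤ/L)^{n+1}`, `L ≥ 3`, uniformly in `L`, and infinite-volume limit states of member families); nothing continuum / Clay.
WHAT IS NEW.  The member version of `StringTensionAxisFloor`: for `W ∈ ClusterDomainFR ε₀ ε₁ r` the Dobrushin matrix of the perturbed slab law is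
`A·m(z,w) + √N Λ(z,w)` (`A = K e^{ε₀}(1 + 2√N ε₁)|β/N|`, cross-Lipschitz loads `Λ` with rows `≤ ε₁` supported within slice graph distance
`s = max(n r, 1)`).  Along the axis vector `u(z) = g(z_ī − y_ī)` of the cycle eigenvector, `∑_w m(z,w) u(w) ≤ (2(n−1) + θ + θ⁻¹) u(z)` and,
by the one-step ratio bound `g(k±1) ≤ θ⁻¹ g(k)`, `u(w) ≤ θ^{−s} u(z)` on the support of `Λ(z,·)`; so `u` is a supersolution as soon as
`A(2(n−1) + θ + θ⁻¹) + √N ε₁ θ^{−s} ≤ 1` (`slabLaw_member_entry_cov_le_axis`: slab two-point `≤ 16N θ^R` on axis pairs).  Consequences: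
★ `abs_expectation_wilsonLoop_le_onBall_axis` (|⟨W_{R×T}⟩_{β,W,L}| ≤ N(64N³)^T θ^{RT/mv} for every member of `ClusterDomainFR ε₀ ε₁ r ∩ IsSlabLocal mv`,
every `L ≥ 3`), ★★ `hasAreaLawWith_onBall_axis` / `stringTension_ge_onBall_axis` (every limit state of every eventually-member family:
`HasAreaLawWith μ χ_N (64N³) ((−log θ)/mv)`, `σ ≥ (−log θ)/mv` whenever `σ` exists, static-potential floor), and the certified cell
★★ `su2_stringTension_ge_sprintBall_axis`: SU(2), d = 4, sprint ball `(β_W, ε₀, ε₁) = (1/8, 37/125, 37/250)`, range `r = 1`: `σ ≥ log(10/7)/mv ≥ 0.356/mv`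
(landed `su2_stringTension_ge_sprintBall`: `log(100/57)/(3·mv) ≈ 0.187/mv`).  The loads enter with weight `θ^{−max(nr,1)}` (the tree's `nbrBall` has
ℓ¹ radius `n r`): honest but lossy for long ranges.  Floors are door artefacts, not computations of `σ`.

References: Durhuus–Fröhlich CMP 75 (1980); Cao–Nissim–Sheffield arXiv:2509.04688v2 Thm 2.3; H. Föllmer, LNM 1362 (1988) Ch. I (2.8), (2.13).
-/

noncomputable section

open MeasureTheory ProbabilityTheory Filter Topology
open Literature.Probability.LatticeModels hiding glue
open Literature.Probability.LatticeModels.DobrushinMetric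
open Literature.MathematicalPhysics.QuantumLattice (fundamentalRep continuous_fundamentalRep fundamentalRep_apply normalisedCharacter)
open Literature.MathematicalPhysics.QuantumFieldTheory hiding ZdEdge
open Literature.MathematicalPhysics.QuantumFieldTheory.DurhuusFrohlich
open Literature.MathematicalPhysics.QuantumFieldTheory.Balaban1983to89.StrongCouplingDobrushinWindow (OneLinkKRModulus)
open Summit.Ventures.YMGap.RobustBall.DobrushinSupersolution Summit.Ventures.YMGap.RobustBall.SlabAxisProfile

namespace Summit.Ventures.YMGap.RobustBall

variable {n L N : ℕ}

/-! ### The cycle profile along a path -/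

section Profile

variable [NeZero L]

omit [NeZero L] in
/-- One-step ratios iterate: `g(k + m) ≤ θ^{−m} g(k)` and `g(k − m) ≤ θ^{−m} g(k)`. [folklore] -/
theorem profile_shift_nat_le {θ : ℝ} (hθ0 : 0 < θ) {g : ZMod L → ℝ}
    (hup : ∀ k : ZMod L, g (k + 1) ≤ θ⁻¹ * g k) (hdn : ∀ k : ZMod L, g (k - 1) ≤ θ⁻¹ * g k) (m : ℕ) (k : ZMod L) :
    g (k + m) ≤ θ⁻¹ ^ m * g k ∧ g (k - m) ≤ θ⁻¹ ^ m * g k := by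
  have hi : 0 ≤ θ⁻¹ := inv_nonneg.2 hθ0.le
  induction m with
  | zero => simp
  | succ m ih =>
    constructor
    · calc g (k + (m + 1 : ℕ)) = g (k + m + 1) := by push_cast; ring_nf
        _ ≤ θ⁻¹ * g (k + m) := hup _
        _ ≤ θ⁻¹ * (θ⁻¹ ^ m * g k) := mul_le_mul_of_nonneg_left ih.1 hi
        _ = θ⁻¹ ^ (m + 1) * g k := by ring
    · calc g (k - (m + 1 : ℕ)) = g (k - m - 1) := by push_cast; ring_nf
        _ ≤ θ⁻¹ * g (k - m) := hdn _
        _ ≤ θ⁻¹ * (θ⁻¹ ^ m * g k) := mul_le_mul_of_nonneg_left ih.2 hi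
        _ = θ⁻¹ ^ (m + 1) * g k := by ring

omit [NeZero L] in
/-- **The profile along a path**: if the cyclic distance between `a` and `b` is `≤ s`, then `g(a) ≤ θ^{−s} g(b)` (`0 < θ ≤ 1`). [folklore] -/
theorem profile_le_of_cycDist_le {θ : ℝ} (hθ0 : 0 < θ) (hθ1 : θ ≤ 1) {g : ZMod L → ℝ} (hg0 : ∀ k, 0 ≤ g k)
    (hup : ∀ k : ZMod L, g (k + 1) ≤ θ⁻¹ * g k) (hdn : ∀ k : ZMod L, g (k - 1) ≤ θ⁻¹ * g k) {a b : ZMod L} {s : ℕ}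
    (hab : ((a - b).valMinAbs).natAbs ≤ s) : g a ≤ θ⁻¹ ^ s * g b := by
  have hi1 : 1 ≤ θ⁻¹ := one_le_inv_iff₀.2 ⟨hθ0, hθ1⟩
  set v : ℤ := (a - b).valMinAbs with hv
  have hav : a = b + (v : ZMod L) := by rw [hv, ZMod.coe_valMinAbs]; ring
  have hmono : θ⁻¹ ^ v.natAbs * g b ≤ θ⁻¹ ^ s * g b :=
    mul_le_mul_of_nonneg_right (pow_le_pow_right₀ hi1 hab) (hg0 b)
  rcases le_or_gt 0 v with h0 | h0
  · have hcast : (v : ZMod L) = ((v.natAbs : ℕ) : ZMod L) := by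
      rw [← Int.cast_natCast (R := ZMod L), Int.natAbs_of_nonneg h0]
    rw [hav, hcast]
    exact (profile_shift_nat_le hθ0 hup hdn v.natAbs b).1.trans hmono
  · have hv' : v = -((v.natAbs : ℕ) : ℤ) := by rw [Int.ofNat_natAbs_of_nonpos h0.le]; ring
    have hcast : (v : ZMod L) = -((v.natAbs : ℕ) : ZMod L) := by
      conv_lhs => rw [hv']
      rw [Int.cast_neg, Int.cast_natCast]
    rw [hav, hcast, ← sub_eq_add_neg]
    exact (profile_shift_nat_le hθ0 hup hdn v.natAbs b).2.trans hmono

omit [NeZero L] in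
/-- The axis vector along the slice: `u(w) ≤ θ^{−s} u(z)` whenever `torusGraphDist z w ≤ s`. [folklore] -/
theorem axis_le_of_torusGraphDist_le {θ : ℝ} (hθ0 : 0 < θ) (hθ1 : θ ≤ 1) {g : ZMod L → ℝ} (hg0 : ∀ k, 0 ≤ g k)
    (hup : ∀ k : ZMod L, g (k + 1) ≤ θ⁻¹ * g k) (hdn : ∀ k : ZMod L, g (k - 1) ≤ θ⁻¹ * g k)
    (y : Site n L) (ī : Fin n) {z w : Site n L} {s : ℕ} (hzw : torusGraphDist z w ≤ s) :
    g (w ī - y ī) ≤ θ⁻¹ ^ s * g (z ī - y ī) := by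
  refine profile_le_of_cycDist_le hθ0 hθ1 hg0 hup hdn ?_
  have h1 : w ī - y ī - (z ī - y ī) = -(z ī - w ī) := by ring
  rw [h1, ZMod.natAbs_valMinAbs_neg]
  refine le_trans ?_ hzw
  unfold torusGraphDist
  exact Finset.single_le_sum (f := fun i => ((z i - w i).valMinAbs).natAbs) (fun i _ => Nat.zero_le _) (Finset.mem_univ ī)

end Profile

/-! ### The member slab laws: axis-separated two-point function at rate `θ` -/

section Member

variable [NeZero L]

/-- **THE MEMBER SLAB TWO-POINT FUNCTION AT AXIS RATE.**  `SU(N)`, `N ≥ 1`, slice `(ℤ/L)^n`, `L ≥ 3`, 't Hooft coupling `βt`, one-link modulus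
`OneLinkKRModulus N R K` on the slab ball `R ≥ 2n|βt|`; a member `W ∈ ClusterDomainFR ε₀ ε₁ r` (`ε₁ ≥ 0`); `A := K e^{ε₀}(1 + 2√N ε₁)|βt|`,
`s := max(n r, 1)`.  For every `0 < θ ≤ 1` with the AXIS SUPERSOLUTION CONDITION `A(2(n−1) + θ + θ⁻¹) + √N ε₁ θ^{−s} ≤ 1` and the row
condition `e^{ε₀}(1 + 2√N ε₁)(2n|βt|K) + √N ε₁ < 1`: every height, rest, slice site `y`, horizontal direction `ī`, `2R' ≤ L`, all entries,
`φ, ψ ∈ {Re, Im}`:  `|Cov(φ(Q_{y + R' e_ī})_{ij}, ψ(Q_y⁻¹)_{kl})| ≤ 16N θ^{R'}`. [cite: Follmer1988, Ch. I Theorem (2.13)] -/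
theorem slabLaw_member_entry_cov_le_axis (hN : 1 ≤ N) (hL : 3 ≤ L) (βt : ℝ) {R K : ℝ} (hK : 0 ≤ K)
    (hmod : OneLinkKRModulus N R K) (hR : |βt| * (2 * (n : ℝ)) ≤ R) {ε₀ ε₁ : ℝ} (h₁ : 0 ≤ ε₁) (r : ℕ)
    {θ : ℝ} (hθ0 : 0 < θ) (hθ1 : θ ≤ 1)
    (hsup : K * Real.exp ε₀ * (1 + 2 * Real.sqrt N * ε₁) * |βt| * (2 * ((n : ℝ) - 1) + θ + θ⁻¹) +
      Real.sqrt N * ε₁ * θ⁻¹ ^ (max (n * r) 1) ≤ 1)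
    (hc : Real.exp ε₀ * (1 + 2 * Real.sqrt N * ε₁) * (2 * (n : ℝ) * |βt| * K) + Real.sqrt N * ε₁ < 1)
    (W : Perturbation (n + 1) L N) (hWball : W ∈ ClusterDomainFR ε₀ ε₁ r)
    (v : Fin (n + 1)) (t : ZMod L) (rest : {e : Edge (n + 1) L // ¬ IsSlab v t e} → SU N) (y : Site n L) (ī : Fin n)
    {R' : ℕ} (hRL : 2 * R' ≤ L) (i j k l : Fin N) (φ ψ : ℂ → ℝ) (hφ : φ = Complex.re ∨ φ = Complex.im)
    (hψ : ψ = Complex.re ∨ ψ = Complex.im) :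
    |cov[fun Q => φ ((Q (y + Pi.single ī ((R' : ℕ) : ZMod L)) : Matrix (Fin N) (Fin N) ℂ) i j),
        fun Q => ψ ((((Q y)⁻¹ : Matrix.specialUnitaryGroup (Fin N) ℂ) : Matrix (Fin N) (Fin N) ℂ) k l);
        slabLawW v t βt W.total rest]| ≤ 16 * N * θ ^ R' := by
  classical
  obtain ⟨hrange, w, hosc, hlip⟩ := hWball
  have hsl : ∀ e, w.selfLipLoad 0 e ≤ ε₁ := fun e =>
    le_trans (le_add_of_nonneg_right (Finset.sum_nonneg fun y _ => crossLip_nonneg w 0 e y)) (hlip e)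
  have hcl : ∀ e, w.crossLipLoad 0 e ≤ ε₁ := fun e =>
    le_trans (le_add_of_nonneg_left (Finset.sum_nonneg fun X _ =>
      mul_nonneg (Real.exp_pos _).le ((w.lip_spec X).nonneg e))) (hlip e)
  have hL1 : L ≠ 1 := by omega
  have hWm := W.measurable_total
  have hWb := W.exists_abs_total_le
  set x : Site n L := y + Pi.single ī ((R' : ℕ) : ZMod L) with hx
  set s : ℕ := max (n * r) 1 with hs
  -- the door of the member
  have hγ := isSpecification_slabSpecW (n := n) (L := L) v t βt hWm hWb rest
  have hKR := isKRContraction_slabSpecW (n := n) (L := L) (N := N) (W := W.total) hN hL1 v t (β := βt) (R := R) (K := K)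
    (δ := ε₀) (ℓ := ε₁) hK h₁ hR hmod hWm hWb rest (nbrBall r) (not_mem_nbrBall r)
    (fun x' η η' h => siteTiltW_total_dep W rest hrange x' η η' h)
    (fun x' ω g g' => (siteTiltW_total_osc W rest w x' ω g g').trans (hosc _))
    (fun x' ω g g' => (siteTiltW_total_lip W rest w x' ω g g').trans
      (mul_le_mul_of_nonneg_right (hsl _) (suFrobDist_nonneg _ _)))
    (crossCoeff W w v t) (fun x' y' => crossCoeff_nonneg W w x' y') (fun x' y' ω η h => siteTiltW_total_cross W rest w x' y' h)
  have hrows := fun z => slabW_rowsum_le (N := N) z (β := βt) (δ := ε₀) hK h₁ (nbrBall r) (crossCoeff W w v t)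
    ((crossCoeff_rowsum_le W w r z).trans (hcl _))
  have hc0 : 0 ≤ Real.exp ε₀ * (1 + 2 * Real.sqrt N * ε₁) * (2 * (n : ℝ) * |βt| * K) + Real.sqrt N * ε₁ := by positivity
  -- the cycle profile and the axis vector centred at `y`
  obtain ⟨g, hg0, -, hg1, hgnb, hgR, hup, hdn⟩ := exists_cycleProfile (L := L) hL hθ0 hθ1
  set u : Site n L → ℝ := fun z => g (z ī - y ī) with hu
  obtain ⟨hfm, hfdep, hf1, hfL⟩ := Slab.entryObs_props (n := n) (L := L) x i j hφ
  obtain ⟨hgm, hgdep, hg1', hgL⟩ := Slab.invEntryObs_props (n := n) (L := L) y k l hψ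
  haveI := isProbabilityMeasure_slabLawW (n := n) (L := L) (N := N) v t βt hWm hWb rest
  -- the supersolution inequality at every `z ≠ y`
  have hsuper : ∀ z, z ∉ ({y} : Finset (Site n L)) →
      ∑ w' ∈ Slab.slabNbr z ∪ nbrBall r z, (K * Real.exp ε₀ * (1 + 2 * Real.sqrt N * ε₁) * |βt| *
        (Slab.slabInfluence z w' : ℝ) + Real.sqrt N * crossCoeff W w v t z w') * u w' ≤ u z := by
    intro z _
    set A : ℝ := K * Real.exp ε₀ * (1 + 2 * Real.sqrt N * ε₁) * |βt| with hA
    have hA0 : 0 ≤ A := by positivity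
    have hm := sum_slabInfluence_mul_axis_le (n := n) (L := L) z (S := Slab.slabNbr z ∪ nbrBall r z)
      Finset.subset_union_left (θ := θ) (fun k' => (hg0 k').le) hgnb ī y
    have hΛ : ∑ w' ∈ Slab.slabNbr z ∪ nbrBall r z, crossCoeff W w v t z w' * u w' ≤ ε₁ * (θ⁻¹ ^ s * u z) := by
      calc ∑ w' ∈ Slab.slabNbr z ∪ nbrBall r z, crossCoeff W w v t z w' * u w'
          ≤ ∑ w' ∈ Slab.slabNbr z ∪ nbrBall r z, crossCoeff W w v t z w' * (θ⁻¹ ^ s * u z) :=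
            Finset.sum_le_sum fun w' hw' => mul_le_mul_of_nonneg_left
              (axis_le_of_torusGraphDist_le hθ0 hθ1 (fun k' => (hg0 k').le) hup hdn y ī (dist_le_of_mem_nbr r z w' hw'))
              (crossCoeff_nonneg W w z w')
        _ = (∑ w' ∈ Slab.slabNbr z ∪ nbrBall r z, crossCoeff W w v t z w') * (θ⁻¹ ^ s * u z) := (Finset.sum_mul _ _ _).symm
        _ ≤ ε₁ * (θ⁻¹ ^ s * u z) := mul_le_mul_of_nonneg_right ((crossCoeff_rowsum_le W w r z).trans (hcl _))
            (mul_nonneg (pow_nonneg (inv_nonneg.2 hθ0.le) _) (hg0 _).le)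
    calc ∑ w' ∈ Slab.slabNbr z ∪ nbrBall r z, (A * (Slab.slabInfluence z w' : ℝ) + Real.sqrt N * crossCoeff W w v t z w') * u w'
        = A * ∑ w' ∈ Slab.slabNbr z ∪ nbrBall r z, (Slab.slabInfluence z w' : ℝ) * g (w' ī - y ī) +
            Real.sqrt N * ∑ w' ∈ Slab.slabNbr z ∪ nbrBall r z, crossCoeff W w v t z w' * u w' := by
          rw [Finset.mul_sum, Finset.mul_sum, ← Finset.sum_add_distrib]
          refine Finset.sum_congr rfl fun w' _ => ?_; simp only [hu]; ring
      _ ≤ A * ((2 * ((n : ℝ) - 1) + θ + θ⁻¹) * g (z ī - y ī)) + Real.sqrt N * (ε₁ * (θ⁻¹ ^ s * u z)) :=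
          add_le_add (mul_le_mul_of_nonneg_left hm hA0) (mul_le_mul_of_nonneg_left hΛ (Real.sqrt_nonneg _))
      _ = (A * (2 * ((n : ℝ) - 1) + θ + θ⁻¹) + Real.sqrt N * ε₁ * θ⁻¹ ^ s) * u z := by simp only [hu]; ring
      _ ≤ 1 * u z := mul_le_mul_of_nonneg_right (by rw [hA, hs]; exact hsup) (hg0 _).le
      _ = u z := one_mul _
  -- the supersolution covariance estimate, `k → ∞`
  have key : ∀ m : ℕ, |cov[fun Q => φ ((Q x : Matrix (Fin N) (Fin N) ℂ) i j),
      fun Q => ψ ((((Q y)⁻¹ : Matrix.specialUnitaryGroup (Fin N) ℂ) : Matrix (Fin N) (Fin N) ℂ) k l);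
      slabLawW v t βt W.total rest]| ≤ 2 * (2 * Real.sqrt N) ^ 2 * 1 *
        ((min 1 (u x) + (Real.exp ε₀ * (1 + 2 * Real.sqrt N * ε₁) * (2 * (n : ℝ) * |βt| * K) + Real.sqrt N * ε₁) ^ m) * 1) := by
    intro m
    have h := abs_covariance_le_of_supersolution hγ hKR suFrobDist_nonneg suFrobDist_le (by positivity) hc0 hc.le hrows
      (isGibbsMeasure_slabLawW v t βt hWm hWb rest) hfm (Δf := {x}) (by simpa using hfdep) hf1 hfL hgm (Δg := {y})
      (by simpa using hgdep) hg1' hgL (v := u) (fun z => (hg0 _).le)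
      (fun z hz => by rw [Finset.mem_singleton.1 hz]; simp only [hu, sub_self]; exact hg1) hsuper m
    simpa using h
  have hux : u x ≤ 2 * θ ^ R' := by
    simp only [hu, hx, Pi.add_apply, Pi.single_eq_same, add_sub_cancel_left]
    exact hgR R' hRL
  have hN8 : (2 : ℝ) * (2 * Real.sqrt N) ^ 2 = 8 * N := by
    rw [mul_pow, Real.sq_sqrt (Nat.cast_nonneg N)]; ring
  have hlim : Tendsto (fun m : ℕ => 8 * (N : ℝ) * (min 1 (u x) +
      (Real.exp ε₀ * (1 + 2 * Real.sqrt N * ε₁) * (2 * (n : ℝ) * |βt| * K) + Real.sqrt N * ε₁) ^ m)) atTop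
      (𝓝 (8 * (N : ℝ) * (min 1 (u x) + 0))) :=
    (tendsto_const_nhds.add (tendsto_pow_atTop_nhds_zero_of_lt_one hc0 hc)).const_mul _
  rw [add_zero] at hlim
  have hle : |cov[fun Q => φ ((Q x : Matrix (Fin N) (Fin N) ℂ) i j),
      fun Q => ψ ((((Q y)⁻¹ : Matrix.specialUnitaryGroup (Fin N) ℂ) : Matrix (Fin N) (Fin N) ℂ) k l);
      slabLawW v t βt W.total rest]| ≤ 8 * N * min 1 (u x) :=
    ge_of_tendsto' hlim fun m => by have := key m; rw [hN8] at this; linarith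
  calc _ ≤ 8 * N * min 1 (u x) := hle
    _ ≤ 8 * N * (2 * θ ^ R') := mul_le_mul_of_nonneg_left ((min_le_right _ _).trans hux) (by positivity)
    _ = 16 * N * θ ^ R' := by ring

/-- **AREA LAW ON THE TIER-1 BALL AT AXIS RATE** (tree coupling `β`, 't Hooft `β/N`; data as in `slabLaw_member_entry_cov_le_axis` with `βt = β/N`):
for every torus `L ≥ 3`, every member `W ∈ ClusterDomainFR ε₀ ε₁ r` with `IsSlabLocal mv W`, `mv ≥ 1`, every base point, plane and `2R', 2T ≤ L`:
`|⟨W_{R'×T}⟩_{μ_{β,W,L}}| ≤ N · (64N³)^T · e^{−((−log θ)/mv) R' T}`. [cite: CaoNissimSheffield2025dynamical, Theorem 2.3] -/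
theorem abs_expectation_wilsonLoop_le_onBall_axis (hN : 2 ≤ N) (hL : 3 ≤ L) (β : ℝ) {R K : ℝ} (hK : 0 ≤ K)
    (hmod : OneLinkKRModulus N R K) (hR : |β / N| * (2 * (n : ℝ)) ≤ R) {ε₀ ε₁ : ℝ} (h₁ : 0 ≤ ε₁) (r : ℕ) {mv : ℕ} (hmv : 1 ≤ mv)
    {θ : ℝ} (hθ0 : 0 < θ) (hθ1 : θ ≤ 1)
    (hsup : K * Real.exp ε₀ * (1 + 2 * Real.sqrt N * ε₁) * |β / N| * (2 * ((n : ℝ) - 1) + θ + θ⁻¹) +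
      Real.sqrt N * ε₁ * θ⁻¹ ^ (max (n * r) 1) ≤ 1)
    (hc : Real.exp ε₀ * (1 + 2 * Real.sqrt N * ε₁) * (2 * (n : ℝ) * |β / N| * K) + Real.sqrt N * ε₁ < 1)
    (W : Perturbation (n + 1) L N) (hWball : W ∈ ClusterDomainFR ε₀ ε₁ r) (hWloc : IsSlabLocal mv W)
    (x : Site (n + 1) L) {i j : Fin (n + 1)} (hij : i ≠ j) {R' T : ℕ} (hRL : 2 * R' ≤ L) (hTL : 2 * T ≤ L) :
    |W.expectation (fundamentalRep (Fin N)) β (wilsonLoop (fundamentalRep (Fin N)) x i j R' T)| ≤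
      N * (64 * (N : ℝ) ^ 3) ^ T * Real.exp (-(-Real.log θ / mv) * ((R' : ℝ) * T)) := by
  have hNr : (N : ℝ) ≠ 0 := by exact_mod_cast (show N ≠ 0 by omega)
  have hN1 : (1 : ℝ) ≤ N := by exact_mod_cast (show 1 ≤ N by omega)
  have hβ : (N : ℝ) * (β / N) = β := by field_simp
  have hC₁ : (0 : ℝ) ≤ 16 * N := by positivity
  have hC₂ : 0 ≤ -Real.log θ := neg_nonneg.2 (Real.log_nonpos hθ0.le hθ1)
  have h := abs_expectation_wilsonLoop_le_axis_rate (n := n) (L := L) hN (β / N) W hmv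
    (fun v => hasVerticalRange_total_of_isSlabLocal hWloc v)
    (fun v t U => total_slabRotate_centre_of_isSlabLocal (by omega) hWloc v t U) (R := R') hC₁ hC₂
    (fun v t rest y ī i' j' k l φ ψ hφ hψ => by
      have h1 := slabLaw_member_entry_cov_le_axis (n := n) (L := L) (N := N) (by omega) hL (β / N) hK hmod hR h₁ r hθ0 hθ1
        hsup hc W hWball v t rest y ī hRL i' j' k l φ ψ hφ hψ
      rwa [← Real.rpow_natCast, ← Real.exp_log hθ0, ← Real.exp_mul, show Real.log θ * (R' : ℕ) = -(-Real.log θ) * R' by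
        ring] at h1)
    x hij hTL
  rw [hβ] at h
  have hmax : max (4 * (16 * (N : ℝ))) 1 = 64 * N := by rw [max_eq_left (by nlinarith)]; ring
  have hpow : (N : ℝ) ^ 2 * (64 * N) = 64 * (N : ℝ) ^ 3 := by ring
  rw [hmax, hpow] at h
  exact h

end Member

/-! ### Limit states of member families -/

namespace AreaLawAxisBall

open Literature.MathematicalPhysics.QuantumLattice

/-- **`ℤ^d` AREA LAW AND STRING-TENSION FLOOR ON THE BALL AT AXIS RATE.**  `SU(N)`, `N ≥ 2`, dimension `n + 1 ≥ 2`, tree coupling `β`; data as in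
`abs_expectation_wilsonLoop_le_onBall_axis`.  EVERY infinite-volume limit state `μ` of EVERY family eventually in `ClusterDomainFR ε₀ ε₁ r ∩ IsSlabLocal mv`
satisfies `HasAreaLawWith μ χ_N (64N³) ((−log θ)/mv)`; hence `σ ≥ (−log θ)/mv` whenever `HasStringTension μ χ_N σ` (existence is NOT asserted for
non-Wilson members), and `((−log θ)/mv) R' − log((64N³)²) ≤ V` whenever `HasStaticPotential μ χ_N R' V`, `R' ≥ 1`. [folklore] -/
theorem hasAreaLawWith_onBall_axis (hN : 2 ≤ N) (hn : 1 ≤ n) (β : ℝ) {R K : ℝ} (hK : 0 ≤ K)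
    (hmod : OneLinkKRModulus N R K) (hR : |β / N| * (2 * (n : ℝ)) ≤ R) {ε₀ ε₁ : ℝ} (h₁ : 0 ≤ ε₁) (r : ℕ) {mv : ℕ} (hmv : 1 ≤ mv)
    {θ : ℝ} (hθ0 : 0 < θ) (hθ1 : θ ≤ 1)
    (hsup : K * Real.exp ε₀ * (1 + 2 * Real.sqrt N * ε₁) * |β / N| * (2 * ((n : ℝ) - 1) + θ + θ⁻¹) +
      Real.sqrt N * ε₁ * θ⁻¹ ^ (max (n * r) 1) ≤ 1)
    (hc : Real.exp ε₀ * (1 + 2 * Real.sqrt N * ε₁) * (2 * (n : ℝ) * |β / N| * K) + Real.sqrt N * ε₁ < 1)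
    (𝓦 : PerturbationFamily (n + 1) N) (h𝓦 : ∀ᶠ L : ℕ in atTop, 𝓦 L ∈ ClusterDomainFR ε₀ ε₁ r ∧ IsSlabLocal mv (𝓦 L))
    {μ : Measure (LGConfig (n + 1) (SUN N))} (hμ : μ ∈ perturbedLimitPoints β 𝓦) :
    haveI : NeZero (n + 1) := ⟨by omega⟩
    HasAreaLawWith μ (fun g => normalisedCharacter N (fundamentalRep (Fin N) g)) (64 * (N : ℝ) ^ 3) (-Real.log θ / mv) ∧
    (∀ σ : ℝ, HasStringTension μ (fun g => normalisedCharacter N (fundamentalRep (Fin N) g)) σ → -Real.log θ / mv ≤ σ) ∧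
    (∀ (R' : ℕ) (V : ℝ), 1 ≤ R' → HasStaticPotential μ (fun g => normalisedCharacter N (fundamentalRep (Fin N) g)) R' V →
      -Real.log θ / mv * R' - Real.log ((64 * (N : ℝ) ^ 3) ^ 2) ≤ V) := by
  haveI : NeZero (n + 1) := ⟨by omega⟩
  have hN1 : (1 : ℝ) ≤ N := by exact_mod_cast (show 1 ≤ N by omega)
  have hND : (N : ℝ) ≤ 64 * (N : ℝ) ^ 3 := by
    have h3 : (N : ℝ) ≤ (N : ℝ) ^ 3 := le_self_pow₀ hN1 (by norm_num)
    nlinarith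
  have h01 : (0 : Fin (n + 1)) ≠ 1 := fin_zero_ne_one_of_two_le (by omega)
  have hmem : ∀ᶠ L : ℕ in atTop, 𝓦 L ∈ {W : Perturbation (n + 1) (L + 1) N |
      (W ∈ ClusterDomainFR ε₀ ε₁ r ∧ IsSlabLocal mv W) ∧ 3 ≤ L + 1} := by
    filter_upwards [h𝓦, eventually_ge_atTop 2] with L hL hL2
    exact ⟨hL, by omega⟩
  have hA : HasAreaLawWith μ (fun g => normalisedCharacter N (fundamentalRep (Fin N) g)) (64 * (N : ℝ) ^ 3) (-Real.log θ / mv) := by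
    refine hasAreaLawWith_of_torusBound (β := β)
      (fun L => {W : Perturbation (n + 1) (L + 1) N | (W ∈ ClusterDomainFR ε₀ ε₁ r ∧ IsSlabLocal mv W) ∧ 3 ≤ L + 1})
      (fun L W hW R' T hR' _ hRL hTL => ?_) 𝓦 hmem hμ
    have h := abs_expectation_wilsonLoop_le_onBall_axis (n := n) (L := L + 1) hN hW.2 β hK hmod hR h₁ r hmv hθ0 hθ1 hsup hc
      W hW.1.1 hW.1.2 (0 : Site (n + 1) (L + 1)) h01 hRL hTL
    exact StringTensionExplicit.le_pow_perimeter_of_le hN1 hND (Real.exp_pos _).le hR' h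
  exact ⟨hA, fun σ hσ => hA.le_of_hasStringTension hσ,
    fun R' V hR' hV => linear_le_of_hasAreaLawWith_of_hasStaticPotential hA hR' hV⟩

/-- ★★ **THE SPRINT BALL AT AXIS RATE** (`SU(2)`, `d = 4`, `β_W = 1/8`, tier-1 ball `(ε₀, ε₁) = (37/125, 37/250)`, range `r = 1`, any vertical
window `mv ≥ 1`; `θ = 7/10` is admissible: `A(4 + θ + θ⁻¹) + √2 ε₁ θ^{−3} ≤ 0.98`): every infinite-volume limit state of every eventually-member
family has `σ ≥ log(10/7)/mv` (`≥ 0.356/mv`) whenever `σ` exists — the landed cell `su2_stringTension_ge_sprintBall` gives `log(100/57)/(3 mv) ≈ 0.187/mv`.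
[folklore] -/
theorem su2_stringTension_ge_sprintBall_axis {mv : ℕ} (hmv : 1 ≤ mv) (𝓦 : PerturbationFamily 4 2)
    (h𝓦 : ∀ᶠ L : ℕ in atTop, 𝓦 L ∈ ClusterDomainFR (37 / 125) (37 / 250) 1 ∧ IsSlabLocal mv (𝓦 L))
    {μ : Measure (LGConfig 4 (SUN 2))} (hμ : μ ∈ perturbedLimitPoints (1 / 16) 𝓦) :
    ∀ σ : ℝ, HasStringTension μ (fun g => normalisedCharacter 2 (fundamentalRep (Fin 2) g)) σ →
      Real.log (10 / 7) / mv ≤ σ := by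
  have hmod := SlabAreaLawDimensions.su2_oneLinkKRModulus_of_le_one (R := 3 / 16) (by norm_num)
  have habs : |(1 / 16 : ℝ) / (2 : ℕ)| = 1 / 32 := by rw [abs_of_nonneg (by positivity)]; norm_num
  have he := StringTensionExplicit.exp_37_125_le
  have hs := sqrt_two_le_1415
  have he0 : 0 < Real.exp (37 / 125 : ℝ) := Real.exp_pos _
  have hs0 : 0 ≤ Real.sqrt 2 := Real.sqrt_nonneg _
  have hrow : Real.exp (37 / 125) * (1 + 2 * Real.sqrt 2 * (37 / 250)) * (2 * (3 : ℝ) * (1 / 32) * 1) +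
      Real.sqrt 2 * (37 / 250) < 1 := by
    nlinarith [mul_nonneg he0.le hs0, mul_le_mul he hs hs0 (by norm_num)]
  have hsup : 1 * Real.exp (37 / 125) * (1 + 2 * Real.sqrt 2 * (37 / 250)) * (1 / 32) * (2 * ((3 : ℝ) - 1) + 7 / 10 + (7 / 10)⁻¹) +
      Real.sqrt 2 * (37 / 250) * (7 / 10 : ℝ)⁻¹ ^ (max (3 * 1) 1) ≤ 1 := by
    norm_num
    nlinarith [mul_nonneg he0.le hs0, mul_le_mul he hs hs0 (by norm_num)]
  have h := (hasAreaLawWith_onBall_axis (n := 3) (N := 2) le_rfl (by norm_num) (1 / 16) zero_le_one hmod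
    (by rw [habs]; norm_num) (by norm_num) 1 hmv (θ := 7 / 10) (by norm_num) (by norm_num)
    (by rw [habs]; push_cast; exact hsup) (by rw [habs]; push_cast; linarith) 𝓦 h𝓦 hμ).2.1
  intro σ hσ
  have h' := h σ hσ
  have hlog : Real.log (10 / 7) = -Real.log (7 / 10) := by rw [← Real.log_inv]; norm_num
  rw [hlog]
  exact_mod_cast h'

end AreaLawAxisBall

end Summit.Ventures.YMGap.RobustBall

end
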